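import Mathlib
import Summits.Ventures.DiscreteObjects.Mahler.CensusKernelDeg6
import Summits.Ventures.DiscreteObjects.Mahler.CensusKernelDeg8
import Summits.Ventures.DiscreteObjects.Mahler.CensusKernelDeg10D
import Summits.Ventures.DiscreteObjects.Mahler.CensusRowsKernel
import Summits.Ventures.DiscreteObjects.Mahler.MRWDegree8Measure
import Summits.Ventures.DiscreteObjects.Mahler.SubLehmerDegreeSix
import Summits.Ventures.DiscreteObjects.Mahler.LowDegreeMeasures
import Summits.Ventures.DiscreteObjects.Mahler.Height1CellSymmetry

/-!
# Lehmer's conjecture for every integer polynomial of degree ≤ 11, in the kernel (venture `DiscreteObjects`, target L)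

Cell `pub-namedobj`, seat `pub-namedobj-mahler-g12`. Framing: lottery ticket; floor = certified bounds/negative
ranges.

Consequences of the kernel census rows `degreeCensus_six / eight / ten` (this seat) together with the rows of
degrees `≤ 5` (gens 8–10) and the kernel enclosures of the listed measures (gens 10–11):

* `lehmer_le_of_irreducible_of_natDegree_le_eleven` — an irreducible `P ∈ ℤ[X]` of degree `≤ 11` with `M(P) > 1`
  has `M(P) ≥ M(ℓ) = 1.17628…` (`ℓ` = Lehmer's polynomial);
* `lehmer_le_of_natDegree_le_eleven` — the same for EVERY `P ∈ ℤ[X]` of degree `≤ 11` (factor into irreducibles);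
* `twelve_le_natDegree_of_subLehmer` — a polynomial with `1 < M(P) < M(ℓ)` has degree `≥ 12`
  (improving `six_le_natDegree_of_subLehmer_irreducible`, gen 10);
* `minimalMeasure_degree_eight / _ten` — the degree-8 and degree-10 rows of Mossinghoff–Rhin–Wu's Table 1 as
  theorems: an irreducible `P` of degree `8` (resp. `10`) with `M(P) > 1` has `M(P) ≥ M(x⁸+x⁵-x⁴+x³+1) = 1.2806…`
  (resp. `≥ M(ℓ)`), primitive or not;
* `measure_ge_thirteen_tenths_of_irreducible_degree_six` — degree `6`: `M(P) > 1 ⇒ M(P) ≥ 13/10`.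

Everything here is a CONTROL in the cell's sense (the published complete lists reach degree 44); the point is that
the statements are now theorems of the Lean kernel with the standard axioms.
-/

namespace Summit.Ventures.DiscreteObjects.Mahler

open Polynomial Literature.NumberTheory.MahlerMeasure

/-- The census normal form does not change the measure. -/
theorem intMahlerMeasure_of_census_form {p : ℤ[X]} {l : List ℤ}
    (h : p = ofCoeffs l ∨ p = -ofCoeffs l ∨ p = (ofCoeffs l).comp (-X) ∨ p = -(ofCoeffs l).comp (-X)) :
    intMahlerMeasure p = intMahlerMeasure (ofCoeffs l) := by
  rcases h with h | h | h | h <;> rw [h]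
  · rw [intMahlerMeasure_neg]
  · rw [intMahlerMeasure_comp_neg_X]
  · rw [intMahlerMeasure_neg, intMahlerMeasure_comp_neg_X]

/-- `c8_01` is MRW's degree-8 minimiser `x⁸ + x⁵ - x⁴ + x³ + 1`. -/
theorem ofCoeffs_c8_01_eq : ofCoeffs c8_01 = mrwPoly8 := by
  unfold ofCoeffs c8_01 mrwPoly8
  simp [List.zipIdx]
  ring

/-- `1.176280818259 < M(ℓ) < 1.176280818260` restated for `lehmerPoly`. -/
theorem lehmer_lt_12807 : intMahlerMeasure lehmerPoly < 128063815 / 10 ^ 8 :=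
  lt_trans lehmer_measure_upper_bound (by norm_num)

/-- **Degree 6:** an irreducible `P` of degree `6` with `M(P) > 1` has `M(P) ≥ 13/10`. -/
theorem measure_ge_thirteen_tenths_of_irreducible_degree_six {P : ℤ[X]} (hirr : Irreducible P)
    (hdeg : P.natDegree = 6) (h1 : 1 < intMahlerMeasure P) : 13 / 10 ≤ intMahlerMeasure P := by
  by_contra h
  push Not at h
  obtain ⟨l, hl, -⟩ := degreeCensus_six P hdeg hirr h1 h
  simp at hl

/-- **Degree 8 (MRW Table 1, D = 8):** an irreducible `P` of degree `8` with `M(P) > 1` has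
`M(P) ≥ M(x⁸ + x⁵ - x⁴ + x³ + 1) = 1.28063815…`. -/
theorem minimalMeasure_degree_eight {P : ℤ[X]} (hirr : Irreducible P) (hdeg : P.natDegree = 8)
    (h1 : 1 < intMahlerMeasure P) : intMahlerMeasure mrwPoly8 ≤ intMahlerMeasure P := by
  by_cases h : intMahlerMeasure P < 13 / 10
  · obtain ⟨l, hl, hform⟩ := degreeCensus_eight P hdeg hirr h1 h
    simp only [coresDeg8, List.mem_singleton] at hl
    subst hl
    rw [intMahlerMeasure_of_census_form hform, ofCoeffs_c8_01_eq]
  · push Not at h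
    exact le_trans (le_of_lt (lt_trans mrwPoly8_measure_enclosure.2 (by norm_num))) h

/-- **Degree 10 (MRW Table 1, D = 10):** an irreducible `P` of degree `10` with `M(P) > 1` has `M(P) ≥ M(ℓ)`,
with `ℓ` Lehmer's polynomial. -/
theorem minimalMeasure_degree_ten {P : ℤ[X]} (hirr : Irreducible P) (hdeg : P.natDegree = 10)
    (h1 : 1 < intMahlerMeasure P) : intMahlerMeasure lehmerPoly ≤ intMahlerMeasure P := by
  by_cases h : intMahlerMeasure P < 13 / 10
  · obtain ⟨l, hl, hform⟩ := degreeCensus_ten P hdeg hirr h1 h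
    rw [intMahlerMeasure_of_census_form hform]
    have := coresDeg10_min l hl
    exact this
  · push Not at h
    exact le_trans (le_of_lt (lt_trans lehmer_measure_upper_bound (by norm_num))) h

/-- **Irreducible polynomials of degree `≤ 11` satisfy Lehmer's bound:** `M(P) > 1 ⇒ M(P) ≥ M(ℓ)`. -/
theorem lehmer_le_of_irreducible_of_natDegree_le_eleven {P : ℤ[X]} (hirr : Irreducible P)
    (hdeg : P.natDegree ≤ 11) (h1 : 1 < intMahlerMeasure P) :
    intMahlerMeasure lehmerPoly ≤ intMahlerMeasure P := by
  by_cases h13 : 13 / 10 ≤ intMahlerMeasure P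
  · exact le_trans (le_of_lt (lt_trans lehmer_measure_upper_bound (by norm_num))) h13
  push Not at h13
  have hθ : intMahlerMeasure P < smythTheta := lt_trans h13 (lt_trans (by norm_num) smythTheta_gt)
  obtain ⟨-, ⟨j, hj⟩, hd2⟩ := reciprocal_of_measure_lt_smythTheta hirr h1 hθ
  have hlt4 : intMahlerMeasure P < 13248 / 10000 := lt_trans h13 (by norm_num)
  rcases (by omega : P.natDegree = 2 ∨ P.natDegree = 4 ∨ P.natDegree = 6 ∨ P.natDegree = 8 ∨ P.natDegree = 10)
    with hd | hd | hd | hd | hd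
  · exfalso
    have hφ : (13 : ℝ) / 10 ≤ (1 + Real.sqrt 5) / 2 := by
      have : (2 : ℝ) < Real.sqrt 5 := by
        rw [show (2 : ℝ) = Real.sqrt (2 ^ 2) by rw [Real.sqrt_sq (by norm_num)]]
        exact Real.sqrt_lt_sqrt (by norm_num) (by norm_num)
      linarith
    obtain ⟨l, hl, -⟩ := degreeCensus_two_empty hφ P hd hirr h1 h13
    simp at hl
  · exfalso
    obtain ⟨l, hl, -⟩ := degreeCensus_four P hd hirr h1 hlt4
    simp at hl
  · exact le_trans (le_of_lt (lt_trans lehmer_measure_upper_bound (by norm_num)))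
      (measure_ge_thirteen_tenths_of_irreducible_degree_six hirr hd h1)
  · exact le_trans (le_of_lt lehmer_lt_12807)
      (le_trans (le_of_lt mrwPoly8_measure_enclosure.1) (minimalMeasure_degree_eight hirr hd h1))
  · exact minimalMeasure_degree_ten hirr hd h1

/-- **Lehmer's conjecture holds for every integer polynomial of degree `≤ 11`:**
`M(P) > 1 ⇒ M(P) ≥ M(ℓ) = 1.17628…`. -/
theorem lehmer_le_of_natDegree_le_eleven {p : ℤ[X]} (hdeg : p.natDegree ≤ 11) (h1 : 1 < intMahlerMeasure p) :
    intMahlerMeasure lehmerPoly ≤ intMahlerMeasure p := by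
  classical
  have hp : p ≠ 0 := by
    intro h
    rw [h] at h1
    unfold intMahlerMeasure at h1
    rw [Polynomial.map_zero, mahlerMeasure_zero] at h1
    linarith
  obtain ⟨u, hu⟩ := UniqueFactorizationMonoid.factors_prod hp
  obtain ⟨c, hc, hcu⟩ := Polynomial.isUnit_iff.mp u.isUnit
  set F := UniqueFactorizationMonoid.factors p with hF
  have hFirr : ∀ f ∈ F, Irreducible f := fun f hf => UniqueFactorizationMonoid.irreducible_of_factor f hf
  have hMu : intMahlerMeasure (↑u : ℤ[X]) = 1 := by
    rw [← hcu, intMahlerMeasure_C]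
    rcases Int.isUnit_iff.mp hc with h | h <;> simp [h]
  have hMp : intMahlerMeasure p = (F.map intMahlerMeasure).prod := by
    rw [← hu, intMahlerMeasure_mul, hMu, mul_one, intMahlerMeasure_multiset_prod]
  have hdvd : ∀ f ∈ F, f ∣ p := fun f hf => (Multiset.dvd_prod hf).trans ⟨↑u, hu.symm⟩
  have hge1 : ∀ x ∈ F.map intMahlerMeasure, 1 ≤ x := by
    intro x hx
    obtain ⟨f, hf, rfl⟩ := Multiset.mem_map.mp hx
    exact one_le_intMahlerMeasure (hFirr f hf).ne_zero
  have hprod_ge : ∀ x ∈ F.map intMahlerMeasure, x ≤ (F.map intMahlerMeasure).prod := by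
    intro x hx
    obtain ⟨T, hT⟩ := Multiset.exists_cons_of_mem hx
    rw [hT, Multiset.prod_cons]
    have hT1 : 1 ≤ T.prod :=
      Multiset.one_le_prod (fun y hy => hge1 y (by rw [hT]; exact Multiset.mem_cons_of_mem hy))
    have hx0 : 0 ≤ x := le_trans zero_le_one (hge1 x hx)
    nlinarith
  -- some factor has measure > 1
  by_contra hlt
  push Not at hlt
  have hall : ∀ x ∈ F.map intMahlerMeasure, x = 1 := by
    intro x hx
    obtain ⟨f, hf, rfl⟩ := Multiset.mem_map.mp hx
    by_contra hne
    have hgt : 1 < intMahlerMeasure f := lt_of_le_of_ne (hge1 _ hx) (Ne.symm hne)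
    have hfdeg : f.natDegree ≤ 11 := (natDegree_le_of_dvd (hdvd f hf) hp).trans hdeg
    have h2 := lehmer_le_of_irreducible_of_natDegree_le_eleven (hFirr f hf) hfdeg hgt
    have h3 := hprod_ge _ hx
    rw [← hMp] at h3
    linarith
  have : (F.map intMahlerMeasure).prod = 1 := Multiset.prod_eq_one hall
  rw [← hMp] at this
  linarith

/-- **A sub-Lehmer polynomial has degree at least `12`** (any `P ∈ ℤ[X]` with `1 < M(P) < M(ℓ)`). -/
theorem twelve_le_natDegree_of_subLehmer {P : ℤ[X]} (hP : SubLehmer P) : 12 ≤ P.natDegree := by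
  by_contra h
  push Not at h
  have := lehmer_le_of_natDegree_le_eleven (p := P) (by omega) hP.1
  exact absurd hP.2 (not_lt.mpr this)

/-- Irreducible form (supersedes `six_le_natDegree_of_subLehmer_irreducible`). -/
theorem twelve_le_natDegree_of_subLehmer_irreducible {P : ℤ[X]} (_hirr : Irreducible P) (hP : SubLehmer P) :
    12 ≤ P.natDegree :=
  twelve_le_natDegree_of_subLehmer hP

/-- **Census rows in the engines' format, degrees `6 ≤ n ≤ 11`, below Lehmer's measure:** nothing. -/
theorem heightBoundedCensus_subLehmer_of_le_eleven {n h : ℕ} (hn : n ≤ 11) :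
    HeightBoundedCensus n h (intMahlerMeasure lehmerPoly) [] := by
  refine ⟨fun p hdeg _ h1 h2 => ?_, fun l hl => by simp at hl⟩
  exfalso
  have := lehmer_le_of_natDegree_le_eleven (p := p) (by omega) h1
  linarith

end Summit.Ventures.DiscreteObjects.Mahler
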